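import Summits.RiemannHypothesis.RiemannHypothesis.Theorems.GroundBartaEvenWinsBeyondArchDeflationCertBridge
import Summits.RiemannHypothesis.RiemannHypothesis.Theorems.GroundBartaEvenWinsBeyondArchDeflationSigma
import HarnessLib

/-!
# RiemannHypothesis / GroundBarta — rung 4 (`EvenWinsBeyondArch`, stmt-RiemannHypothesis-18807 / 18085):
# the deflated Temple L-side, XIII b — the certificate bridge beyond `log 2`, with the SIGMA CRITERION

Helper file (`--supports stmt-RiemannHypothesis-18807`), RH-free, Mathlib + landed tree files only, no definitions,
no named facts.  Prover B, speedrun unit `sr-gb-rung-b` (gen 4).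

`dt_weilOddGroundEnergy_ge_of_deflCert` (prover A, file `…DeflationCertBridge`) turns the conclusion of a rank-one augmented
two-prime certificate (`β₂₃`, penalty data `R`, half-width `a₀`) plus the sliver bound into `λ ≤ ε_od(c)` for a window
`c ≤ min(a₀, (log 5)/2)`, GIVEN the `k × k` PSD datum `hPSD` (A-layer AND residual Gram enclosures).  This file is the same bridge
with `hPSD` replaced by the sigma criterion of file XIII (`dt_psd_of_sigma`): `k` residual NORM bounds
`∫‖F_i − Σ_l W_il v_l‖² ≤ s_i`, weights `θ_i > 0`, a budget `Σ s_i/θ_i ≤ τ`, and `(β−λ)(A−λG) − τ·diag θ ⪰ 0` with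
`β = β₂₃ − (log 2)/2` — i.e. exactly what the A-layer (energies) and the R-layer (panel Taylor models, files XIV–XV) deliver
for the ladder cells `[2/3, 18/25]`, `[18/25, 3/4]`, … of item 18085.

References: F. Goerisch, H. Haunhorst, ZAMM 65 (1985) 129–135 [GoerischHaunhorst1985]; N. J. Lehmann, Numer. Math. 5 (1963)
[Lehmann1963]; A. Weinstein, W. Stenger (1972) Ch. 5 §9 [WeinsteinStenger1972].
-/

set_option linter.dupNamespace false

noncomputable section

open MeasureTheory Set Filter Finset
open scoped Topology ComplexConjugate BigOperators

namespace Summit.RiemannHypothesis.RiemannHypothesis.Theorems.EvenWinsBeyondArch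

open Literature.NumberTheory.LFunctions
open Summit.RiemannHypothesis.RiemannHypothesis.Theorems.OddSector (weilDirichletEnergy₂ weilPoleForm₂)

/-- **`λ ≤ ε_od(c)` beyond `log 2` from a deflated two-prime certificate, the sliver bound, and the SIGMA CRITERION.**
Hypotheses as in `dt_weilOddGroundEnergy_ge_of_deflCert` except that the PSD datum is replaced by residual norm bounds
`s_i`, weights `θ_i > 0`, `Σ s_i/θ_i ≤ τ`, and the positive semidefiniteness of `(β₂₃ − (log 2)/2 − λ)(A − λG) − τ·diag θ`.
[cite: GoerischHaunhorst1985, §2] [cite: WeinsteinStenger1972, Ch. 5 §9 eq. (2)] -/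
theorem dt_weilOddGroundEnergy_ge_of_deflCert_sigma {c : ℝ} (hc : 0 < c) (hc5 : c ≤ Real.log 5 / 2)
    {a₀ : ℝ} (hca : c ≤ a₀) (R : List (ℚ × ℕ × List ℚ)) (n : ℕ) {β₂₃ : ℝ}
    (hRodd : ∀ i : Fin R.length, (R.get i).2.1 % 2 = 1) (hRμ : ∀ i : Fin R.length, 0 ≤ (R.get i).1)
    (hcert23 : ∀ g : ℝ → ℂ, IsWeilTest g → tsupport g ⊆ Icc (-a₀) a₀ → (∀ x, g (-x) = -g x) →
      β₂₃ * weilNorm2Sq g ≤ weilTwoPrimeQuadratic g +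
        (R.map fun r ↦ (r.1 : ℝ) * ‖∑ k ∈ Finset.range n, ((maskV r k : ℚ) : ℂ) * weilMoment a₀ g k‖ ^ 2).sum)
    (v F : Fin R.length → ℝ → ℂ)
    (hv : ∀ i x, v i x = (((Icc (-c) c).indicator (fun x ↦ maskPoly (R.get i) n a₀ x) x : ℝ) : ℂ))
    (hF : ∀ i y, F i y = (Icc (-c) c).indicator (fun y ↦
        2 * (∫ x, v i x * (Real.cosh (x / 2) : ℂ)) * (Real.cosh (y / 2) : ℂ) -
          2 * (∫ x, v i x * (Real.sinh (x / 2) : ℂ)) * (Real.sinh (y / 2) : ℂ) +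
        (∑ m ∈ weilPrimeIndex c, (((ArithmeticFunction.vonMangoldt m : ℝ) / Real.sqrt m : ℝ) : ℂ) *
          (2 * v i y - v i (y - Real.log m) - v i (y + Real.log m))) +
        ∫ t in Ioi 0, (weilArchDensity t : ℂ) * (2 * v i y - v i (y - t) - v i (y + t))) y -
      (weilMarkovConstant c : ℂ) * v i y)
    (W : Fin R.length → Fin R.length → ℝ) {lam : ℝ} (hlam : lam < β₂₃ - Real.log 2 / 2)
    (s θ : Fin R.length → ℝ) (hθ : ∀ i, 0 < θ i) (hs : ∀ i, ∫ x, ‖(F i - ∑ l, W i l • v l) x‖ ^ 2 ≤ s i)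
    {τ : ℝ} (hτ : ∑ i, s i / θ i ≤ τ)
    (hN : ∀ α : Fin R.length → ℝ, 0 ≤ ∑ i, ∑ j, α i * α j *
      ((β₂₃ - Real.log 2 / 2 - lam) * ((weilPoleForm₂ (v i) (v j) + weilDirichletEnergy₂ c (v i) (v j) -
          weilMarkovConstant c * ∫ x, (v i x * conj (v j x)).re) - lam * ∫ x, (v i x * conj (v j x)).re) -
        if i = j then τ * θ i else 0)) :
    lam ≤ weilOddGroundEnergy c :=
  dt_weilOddGroundEnergy_ge_of_deflCert hc hc5 hca R n hRodd hRμ hcert23 v F hv hF W hlam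
    (dt_psd_of_sigma _ (fun i ↦ F i - ∑ l, W i l • v l)
      (dt_residual_memLp hc (fun i x ↦ maskPoly (R.get i) n a₀ x) (fun i ↦ contDiff_maskPoly (R.get i) n a₀) v F hv hF W)
      s θ hθ hs hτ hN)

end Summit.RiemannHypothesis.RiemannHypothesis.Theorems.EvenWinsBeyondArch

end
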